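import Summits.ResolutionOfSingularities.ResolutionOfSingularities.Theorems.WildConesCampaignW46AtomChartOrder
import HarnessLib

/-!
# [OURS · L1 W4.6 — the dictionary, SCHEME HALF, brick 13] An adapted regular system of parameters from a formal
# chart (density + Nakayama), and divided images of powers of the maximal ideal

Cell res-hironaka (LADDER-RESOLUTION rung L, D-0089), slot W4.6, seat res-L1-s46-pv-2 (gen 2). Host: route
`WildCones`, crux `ClassicalRegimes` (stmt-ResolutionOfSingularities-16884), `--supports … --as helper`.

HONEST FRAMING. Everything here is OURS — commutative algebra of a Noetherian local ring `R` whose `𝔪`-adic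
completion carries a formal chart `E : R̂ ≅ κ⟦X_σ⟧` (a ring isomorphism): orders are read through `E`
(`mem_maximalIdeal_pow_iff_ringEquiv`), `R` is dense in every jet (`exists_sub_mem_maximalIdeal_pow`), hence `𝔪_R`
has generators ADAPTED to the chart to first order, `E(c_j) ≡ X_j (mod 𝔪̂²)` (`exists_rsop_adapted`: density, the
linear part of a series, Nakayama) — the input shape of bricks 5/8 (`exists_ringEquiv_completion_chart`,
`exists_ringEquiv_transform_atom`); and `g(𝔪_R^k) ⊆ g(c_i)^k · L` for chart-divided generators
(`exists_eq_pow_mul_of_mem_pow`). Used by the rung file `…ForcedAtomTerminates.lean`. NOTHING here is a statement of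
H. Hironaka's manuscript [Hironaka2017]; no FACT-LIST premise. AI review is weaker than expert review.

References: [cite: Matsumura1987, Thm. 8.11] (completion and quotients: `R̂/𝔪̂^N = R/𝔪^N`). [folklore]
-/

noncomputable section

-- single-problem summit: the doubled namespace component `ResolutionOfSingularities` is forced
set_option linter.dupNamespace false

open scoped BigOperators Classical
open MvPowerSeries IsLocalRing

namespace Summit.ResolutionOfSingularities.ResolutionOfSingularities.Theorems

/-! ## Ring level: an adapted regular system of parameters from a formal chart (Nakayama) -/

namespace CampaignW46.FormalChart

open Literature.AlgebraicGeometry.Resolution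
open Literature.RingTheory.MvPowerSeries.Jets (mem_maximalIdeal_pow_of_coeff_eq_zero
  mem_maximalIdeal_iff_constantCoeff_eq_zero)

variable {κ : Type} [Field κ] {σ : Type} [Fintype σ]
  {R : Type} [CommRing R] [IsLocalRing R] [IsNoetherianRing R]

omit [Fintype σ] in
/-- Orders are read through a formal chart: `x ∈ 𝔪_R^k ⟺ E(x) ∈ 𝔪^k`. [cite: Matsumura1987, Thm. 8.11] [folklore] -/
theorem mem_maximalIdeal_pow_iff_ringEquiv (E : AdicCompletion (maximalIdeal R) R ≃+* MvPowerSeries σ κ) (x : R)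
    (k : ℕ) :
    x ∈ maximalIdeal R ^ k ↔
      E (algebraMap R (AdicCompletion (maximalIdeal R) R) x) ∈ maximalIdeal (MvPowerSeries σ κ) ^ k := by
  rw [AtomGerm.mem_maximalIdeal_pow_iff_algebraMap]
  refine ⟨fun h => ringEquiv_mem_maximalIdeal_pow E h, fun h => ?_⟩
  have h' := ringEquiv_mem_maximalIdeal_pow E.symm h
  rwa [RingEquiv.symm_apply_apply] at h'

omit [Fintype σ] in
/-- **Density**: every formal series is approximated to any order by elements of `R` through the chart `E`.
[cite: Matsumura1987, Thm. 8.11] [folklore] -/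
theorem exists_sub_mem_maximalIdeal_pow (E : AdicCompletion (maximalIdeal R) R ≃+* MvPowerSeries σ κ)
    (F : MvPowerSeries σ κ) (N : ℕ) :
    ∃ r : R, E (algebraMap R (AdicCompletion (maximalIdeal R) R) r) - F ∈ maximalIdeal (MvPowerSeries σ κ) ^ N := by
  obtain ⟨r, hr⟩ := Ideal.Quotient.mk_surjective (AdicCompletion.evalₐ (maximalIdeal R) N (E.symm F))
  refine ⟨r, ?_⟩
  have h : algebraMap R (AdicCompletion (maximalIdeal R) R) r - E.symm F ∈
      maximalIdeal (AdicCompletion (maximalIdeal R) R) ^ N := by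
    rw [AdicCompletion.maximalIdeal_eq_map, ← Ideal.map_pow,
      mem_map_pow_adicCompletion_iff _ (maximalIdeal R).fg_of_isNoetherianRing, map_sub,
      AdicCompletion.algebraMap_apply, Algebra.algebraMap_self, RingHom.id_apply, AdicCompletion.evalₐ_of, ← hr,
      sub_self]
  have h' := ringEquiv_mem_maximalIdeal_pow E h
  rwa [map_sub, RingEquiv.apply_symm_apply] at h'

omit [Fintype σ] in
/-- An exponent of degree one is a unit vector. [folklore] -/
theorem exists_eq_single_of_degree_eq_one {e : σ →₀ ℕ} (he : e.degree = 1) : ∃ l, e = Finsupp.single l 1 := by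
  have hne : e ≠ 0 := by
    rintro rfl
    rw [map_zero] at he
    exact zero_ne_one he
  obtain ⟨l, hl⟩ := Finsupp.ne_iff.mp hne
  refine ⟨l, ?_⟩
  have hle : Finsupp.single l 1 ≤ e := Finsupp.single_le_iff.mpr (Nat.one_le_iff_ne_zero.mpr hl)
  obtain ⟨e', rfl⟩ := exists_add_of_le hle
  rw [map_add, Finsupp.degree_single, Nat.add_eq_left, Finsupp.degree_eq_zero_iff] at he
  rw [he, add_zero]

/-- **Linear part**: a series without constant term is congruent modulo `𝔪²` to its linear part. [folklore] -/
theorem sub_linearPart_mem_maximalIdeal_sq (F : MvPowerSeries σ κ) (hF : F ∈ maximalIdeal (MvPowerSeries σ κ)) :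
    F - ∑ j, C (coeff (Finsupp.single j 1) F) * X j ∈ maximalIdeal (MvPowerSeries σ κ) ^ 2 := by
  refine mem_maximalIdeal_pow_of_coeff_eq_zero fun e he => ?_
  rw [map_sub, map_sum]
  simp_rw [coeff_C_mul, coeff_X]
  rcases (Nat.lt_succ_iff.mp he).eq_or_lt with h1 | h0
  · obtain ⟨l, rfl⟩ := exists_eq_single_of_degree_eq_one h1
    rw [Finset.sum_eq_single l, if_pos rfl, mul_one, sub_self]
    · intro j _ hj
      rw [if_neg (fun h => hj (Finsupp.single_left_injective one_ne_zero h).symm), mul_zero]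
    · intro h; exact absurd (Finset.mem_univ l) h
  · have h0' : e = 0 := by
      rw [← Finsupp.degree_eq_zero_iff]; omega
    subst h0'
    rw [coeff_zero_eq_constantCoeff_apply, mem_maximalIdeal_iff_constantCoeff_eq_zero.1 hF, Finset.sum_eq_zero,
      sub_zero]
    intro j _
    rw [if_neg (Finsupp.single_ne_zero.mpr one_ne_zero).symm, mul_zero]

/-- [OURS · L1 W4.6 — DICTIONARY; NOT a statement of the manuscript] **An adapted regular system of parameters.**
A Noetherian local ring whose completion has a formal chart `E : R̂ ≅ κ⟦X_σ⟧` has a system of generators `c` of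
`𝔪_R` adapted to the chart to first order: `E(c_j) ≡ X_j (mod 𝔪̂²)` (density, then Nakayama).
[cite: Matsumura1987, Thm. 8.11] [folklore] -/
theorem exists_rsop_adapted (E : AdicCompletion (maximalIdeal R) R ≃+* MvPowerSeries σ κ) :
    ∃ c : σ → R, Ideal.span (Set.range c) = maximalIdeal R ∧
      ∀ j, E (algebraMap R (AdicCompletion (maximalIdeal R) R) (c j)) - X j ∈
        maximalIdeal (MvPowerSeries σ κ) ^ 2 := by
  set ofR := algebraMap R (AdicCompletion (maximalIdeal R) R) with hofR
  choose c hc using fun j => exists_sub_mem_maximalIdeal_pow E (X j : MvPowerSeries σ κ) 2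
  refine ⟨c, ?_, hc⟩
  have hX : ∀ j, (X j : MvPowerSeries σ κ) ∈ maximalIdeal (MvPowerSeries σ κ) := fun j =>
    mem_maximalIdeal_iff_constantCoeff_eq_zero.2 (constantCoeff_X j)
  -- each `c j ∈ 𝔪_R`
  have hc𝔪 : ∀ j, c j ∈ maximalIdeal R := by
    intro j
    rw [← pow_one (maximalIdeal R), mem_maximalIdeal_pow_iff_ringEquiv E, pow_one,
      ← sub_add_cancel (E (ofR (c j))) (X j)]
    exact Ideal.add_mem _ (Ideal.pow_le_self two_ne_zero (hc j)) (hX j)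
  apply le_antisymm
  · rw [Ideal.span_le]
    rintro _ ⟨j, rfl⟩
    exact hc𝔪 j
  · -- Nakayama: `𝔪 ≤ (c) + 𝔪²`
    refine Submodule.le_of_le_smul_of_le_jacobson_bot (maximalIdeal R).fg_of_isNoetherianRing
      (IsLocalRing.jacobson_eq_maximalIdeal (⊥ : Ideal R) bot_ne_top).ge fun m hm => ?_
    set F := E (ofR m) with hF
    have hF𝔪 : F ∈ maximalIdeal (MvPowerSeries σ κ) := by
      rw [← pow_one (maximalIdeal (MvPowerSeries σ κ)), hF, ← mem_maximalIdeal_pow_iff_ringEquiv E, pow_one]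
      exact hm
    -- constants `s j` with `E(s j) ≡ λ_j`
    choose s hs using fun j =>
      exists_sub_mem_maximalIdeal_pow E (C (coeff (Finsupp.single j 1) F) : MvPowerSeries σ κ) 1
    have hsum : ∑ j, s j * c j ∈ Ideal.span (Set.range c) :=
      Ideal.sum_mem _ fun j _ => Ideal.mul_mem_left _ _ (Ideal.subset_span ⟨j, rfl⟩)
    have hrest : m - ∑ j, s j * c j ∈ maximalIdeal R ^ 2 := by
      rw [mem_maximalIdeal_pow_iff_ringEquiv E]
      simp only [map_sub, map_sum, map_mul]
      have hsplit : F - ∑ j, E (ofR (s j)) * E (ofR (c j)) =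
          (F - ∑ j, C (coeff (Finsupp.single j 1) F) * X j) -
            ∑ j, ((E (ofR (s j)) - C (coeff (Finsupp.single j 1) F)) * X j +
              E (ofR (s j)) * (E (ofR (c j)) - X j)) := by
        rw [sub_sub, ← Finset.sum_add_distrib]
        refine congrArg (F - ·) (Finset.sum_congr rfl fun j _ => ?_)
        ring
      change F - ∑ j, E (ofR (s j)) * E (ofR (c j)) ∈ _
      rw [hsplit]
      refine Ideal.sub_mem _ (sub_linearPart_mem_maximalIdeal_sq F hF𝔪) (Ideal.sum_mem _ fun j _ => ?_)
      refine Ideal.add_mem _ ?_ (Ideal.mul_mem_left _ _ (hc j))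
      rw [pow_two]
      exact Ideal.mul_mem_mul (by simpa only [pow_one] using hs j) (hX j)
    rw [show m = ∑ j, s j * c j + (m - ∑ j, s j * c j) by ring]
    refine Submodule.add_mem_sup hsum ?_
    rw [Ideal.smul_eq_mul, ← pow_two]
    exact hrest

omit [IsLocalRing R] [IsNoetherianRing R] [Fintype σ] in
/-- **Divided images**: if `g(c_j) = g(c_i) · e_j` for generators `c` of an ideal `I`, then `g(I^k) ⊆ g(c_i)^k · L`.
[folklore] -/
theorem exists_eq_pow_mul_of_mem_pow {L : Type} [CommRing L] (g : R →+* L) (c : σ → R) {I : Ideal R}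
    (hc : Ideal.span (Set.range c) = I) (i : σ) (e : σ → L) (he : ∀ j, g (c j) = g (c i) * e j)
    {k : ℕ} {x : R} (hx : x ∈ I ^ k) : ∃ y : L, g x = g (c i) ^ k * y := by
  have h1 : I.map g ≤ Ideal.span {g (c i)} := by
    rw [← hc, Ideal.map_span, Ideal.span_le]
    rintro _ ⟨_, ⟨j, rfl⟩, rfl⟩
    rw [SetLike.mem_coe, he j]
    exact Ideal.mul_mem_right _ _ (Ideal.mem_span_singleton_self _)
  have h2 : g x ∈ Ideal.span {g (c i) ^ k} := by
    rw [← Ideal.span_singleton_pow]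
    refine Ideal.pow_right_mono h1 k ?_
    rw [← Ideal.map_pow]
    exact Ideal.mem_map_of_mem g hx
  obtain ⟨y, hy⟩ := Ideal.mem_span_singleton'.mp h2
  exact ⟨y, by rw [← hy, mul_comm]⟩

end CampaignW46.FormalChart

end Summit.ResolutionOfSingularities.ResolutionOfSingularities.Theorems

end
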